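import Summits.QuantumFields.YangMills.Theorems.BalabanUVNodesN09AtRecord11
import Literature.MathematicalPhysics.QuantumFieldTheory.Balaban1983to89.Node00.CarriersB12Package

/-!
# BalabanUVNodes ∕ N09 ([Balaban1987RG1], `Dag.B12_main`) AT NODE 00's CARRIER-PINNED STAGE-11 RECORDS — the five-pin record `Node00.IsRecordOfRecord₁₁CB10YZWB8`
# (S-bound world; conjunct 1 over the FREE [B12 §§2–5] group) and THE SIX-PIN RECORD `Node00.IsRecordOfRecord₁₁CB10YZWB8B12` = THE STAGE NAMING THE [B12] GROUP:
# conjunct 1 IS LEMMA 4 (3.53) AT THE FRAME OF RECORD `B12LeafOfRecord₁₁ θ λ₁₂ P`; closers BY NAME in both currencies; guards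
# (Track A, DAG node N09; KNIT-BY-NAME seat `pub-ymgap-dag-n09-d` g2, strategy s2, director-ym R134 «conj. 1 at the stage naming the package»; MODULE 4″, 2026-08-26)

T. Bałaban, *Renormalization group approach to lattice gauge field theories. I*, Commun. Math. Phys. **109** (1987) 249–301 [Balaban1987RG1] (= [I]); [Balaban1985Variational]
(= [B11]) Thm 1 p. 279.  THEOREMS ONLY, def-free, sorry-free, standard axioms.  COUNT-NEUTRAL; `--supports` K1 `StabilityBAtRecordR11e` (stmt-QuantumFields-19674).

WHY THIS FILE.  Until node00-def g32's `Node00/CarriersB12` (p453948) + `Node00/Record11CarriersB12` (p454379) every record predicate left the [B12 §§2–5] group of the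
run-indexed carrier `θ.res.X P` FREE, so N09's conjunct 1 could only be DISPLAYED as the pin slot `∀ P, B12Sec2to5.Lemma4Printed (θ.res.X P).F12 (θ.res.X P).c12` over
arbitrary data (MODULES 3′∕4′, `B12NodeKnitRecord11` ∕ `BalabanUVNodesN09AtRecord11`).  At the SIX-PIN record the group IS the frame of Lemma 4 of record
(`F12OfRecord₁₁ θ λ₁₂ P`: 11b's (1.15) recipes `θ.Rz`, cube size `θ.τ9.M`, `O(1)LMB := θ.s2.cB`, the `SU(N)` model, `π = slProj N`) over ONE explicit residual datum
`λ₁₂ : ResidB12 F N θ.τ9.M` (instance index, the [15]-letters `𝐊`, `𝐀₂`, the class (3.31), the constants — data, no law), and the own leaf reads `B12LeafOfRecord₁₁ F N θ λ₁₂ P`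
(`Node00.leaf_b12_iff_of_isRecordOfRecord₁₁CB10YZWB8B12`).  So conjunct 1 becomes a statement ABOUT THE RECORD'S OBJECTS — closable only by content: lit-balaban p07's
`B12Lemma4ConcreteFrame.lemma4Printed_frameOf` through the displayed by-reference package `B12Package` of the companion module `Node00/CarriersB12Package` (seat
node00-def-B12, director-ym LINE №72 (3), p456282), whose face `b12LeafOfRecord₁₁_of_package` fills the slot `hleaf` of `b12_main_of_isRecordOfRecord₁₁CB10YZWB8B12_of_leafSlot`
verbatim (§4).  The Theorem-3 member is MODULE 3′'s θ-explicit
`B12NodeKnitRecord11.thm3Member_stage11_of_hRestrict` at the record's presenting parameters — its binders are the ₁₁C ones VERBATIM ([B11] Thm 1 at the record's level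
domains: (1.1) existence + uniqueness on `domAltOfRecord`, `HRestrict`, uniqueness at the averaged minimisers = N07's content; keyed `∀ θ hP, θ.Admissible → D = datumOfRecord₁₁ F N θ hP →
w.γ ≤ θ.γ → …`, so one [B11]-side producer serves ₁₁C and both carrier records).  The five-pin record (S-bound world, [B8] surviving leaf) is where N24's engine
`Node00.N24KnitStage11Carriers.N24_at_record₁₁CB10YZWB8(_knit_all_carriers_pinned)` takes N09 as the world-level binder `h09 : ∀ P, Dag.B12_main (leavesP w P)`: §1's
`b12_main_of_isRecordOfRecord₁₁CB10YZWB8_of_slot` PRODUCES that binder from the pin slot + the [B11] binders; the six-pin record refines the five-pin one with THE SAME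
`(D, w)` (`Node00.isRecordOfRecord₁₁CB10YZWB8_of_isRecordOfRecord₁₁CB10YZWB8B12`), so §2's producers feed the same engine in one line.

WHAT THIS FILE PROVES.
* §1 AT `IsRecordOfRecord₁₁CB10YZWB8 F N D w`: `b12_main_iff_of_isRecordOfRecord₁₁CB10YZWB8` (N09 IS «b8 → b9 → b10 → b11 → (b12 ∧ member)», the four in-edges
  `b4 … b7` being theorems there — g31's `b4_b5_b6_b7_of_…`); `b12_leaf_iff_of_isRecordOfRecord₁₁CB10YZWB8` (the own leaf = Lemma 4 over the FREE group, read at the view's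
  carrier `((θ.view₁₁B8B10YZW …).res.X P).F12 ∕ .c12` — N24's `slots₁₀` form; generic face `upOfRecord₅CS_b12_iff`, `Iff.rfl`); `thm3Member_of_isRecordOfRecord₁₁CB10YZWB8_of_hRestrict`; **`b12_main_of_isRecordOfRecord₁₁CB10YZWB8_of_slot`**
  (N24's `h09` at the five-pin record from the slot keyed on the five-pin presentations + the [B11] binders).
* §2 AT `IsRecordOfRecord₁₁CB10YZWB8B12 F N D w`: `b12_main_iff_of_isRecordOfRecord₁₁CB10YZWB8B12`; `thm3Member_of_isRecordOfRecord₁₁CB10YZWB8B12_of_hRestrict`;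
  `b12_main_iff_bundles_of_isRecordOfRecord₁₁CB10YZWB8B12` (given the member's binders, N09 READ AT THE SIX PINNED BUNDLES: «`B8LeafOfRecord θ₃ λ` → `B9LeafX (Y9OfRecord N θ₃ M⋆ ops)` → `PrintedUV3V N θ.L`
  → `B11Leaf (Z11OfRecord F N ζ)` → `B12LeafOfRecord₁₁ F N θ λ₁₂ P`»); **`b12_main_of_isRecordOfRecord₁₁CB10YZWB8B12_of_slots`** (g32's slots shape) and
  **`b12_main_of_isRecordOfRecord₁₁CB10YZWB8B12_of_leafSlot`** (the slot keyed on `(θ, hP, λ₁₂)` alone — the shape the companion's package face fills); `s_N09_of_refines₁₁CB10YZWB8B12`;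
  ∃-currency ∕ θ-explicit **`b12_main_of_up_view₁₁B12B8B10YZW_of_leaf`** (at ANY world bound over the six-pin view of a package: `B12LeafOfRecord₁₁` at every run + [B11] Thm 1
  AT `θ` ⇒ `Dag.B12_main` at every run — what N09 costs in K1's «the prover chooses the record» form, for a `λ₁₂` the prover names).
* §4 BY THE COMPANION's PACKAGE FACE (`Node00/CarriersB12Package`, seat node00-def-B12, p456282: `b12LeafOfRecord₁₁_of_package` = p07's `lemma4Printed_frameOf` BY NAME on
  `lemma4DataOfRecord`): **`b12_main_of_isRecordOfRecord₁₁CB10YZWB8B12_of_package`** (conjunct 1 AT THE STAGE NAMING THE PACKAGE: the displayed by-reference package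
  `B12Package (θ.Rz P.K) θ.s2.cB (λ₁₂ P)` — the 7 further restrictions, the 7 region inclusions of the fundamental case, the `JInputs` package on the printed domain, `hKan` ∕ `hA2an` —
  at every presenting `(θ, hP, λ₁₂)` + the [B11] binders ⇒ `Dag.B12_main` at every run) and
  **`b12_main_of_up_view₁₁B12B8B10YZW_of_package`** (∃-currency: the package at a NAMED `λ₁₂` + [B11] Thm 1 at `θ`).
* §3 GUARDS: `inhabited₁₁CB10YZWB8B12_iff_inhabited₁₁CB10YZWB8` (the sixth pin adds no proviso: `Node00.nonempty_residB12`; with n05-d ∕ n08-c's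
  `inhabited₁₁CB10YZWB8_iff_inhabited₁₁C` this is K0's body); `smallCouplings_rebind` ∕ `smallFieldInductive_rebind` (the member reads `w.C`, `w.γ` only: `Iff.rfl` under an
  `up`-re-binding); **`exists_rebind₁₁CB10YZWB8B12_of_isRecordOfRecord₁₁C`** (LOCATED, K1-currency: every ₁₁C record's datum is RE-PRESENTED, for EVERY residual [B12] layer `λ₁₂`
  — and every other layer — OF THE PROVER'S CHOICE, by a six-pin world with the same construction, window and block size at which the own leaf IS `B12LeafOfRecord₁₁ θ λ₁₂ P` and
  the member is the ₁₁C record's; so N09's conjunct 1 in the ∃-form costs EXACTLY Lemma 4 at the frame of record for a NAMED `λ₁₂` — the companion's package at that `λ₁₂` —,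
  never less).
HONEST FRAMING.  Count-neutral kernel bookkeeping BY NAME; nothing of [Balaban1987RG1] ∕ [B11] asserted; every slot ∕ binder DISPLAYED; N09 NOT discharged (conjunct 1 = Lemma 4 at
the frame of record — closable through the companion's displayed package, i.e. p07's `Lemma4Data` law-fields AS HYPOTHESES; member = [B11] Thm 1 at the record's domains = N07);
JUNK CHANNELS (ref-C READ #115 (B4), `CarriersB12` header): `λ₁₂` is law-free data — zero letters `𝐊 = 𝐀₂ = 0`, an empty class `A331` or unsatisfiable `Lemma4Restrictions`
make the leaf TRUE vacuously, wild letters make it FALSE; no closer below excludes either, so a COUNT line through them must DISPLAY `0 ∈ (λ₁₂ P).A331`, satisfiable restrictions and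
non-junk letters at the record it names.  The records are inhabited iff ₁₁C is (K0 `Record11Inhabited`, stmt-QuantumFields-19673, neither proved nor assumed here); one finite
four-torus programme at fixed ε — NOT ℝ⁴, NOT infinite volume, NOT OS, NOT a mass gap, NOT Clay.  Restate-immune (no `def`). -/

noncomputable section

namespace Summit.QuantumFields.YangMills.BalabanUVNodes.N09AtRecord11CB10YZWB8B12

open Literature.MathematicalPhysics.QuantumFieldTheory.Balaban1983to89
open Literature.MathematicalPhysics.QuantumFieldTheory.Balaban1983to89.T4Continuum (T4Family FiniteEpsData)
open Literature.MathematicalPhysics.QuantumFieldTheory.Balaban1983to89.DagBinding (WorldP leavesP B9LeafX B11Leaf)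
open Literature.MathematicalPhysics.QuantumFieldTheory.Balaban1983to89.Node00
open Literature.MathematicalPhysics.QuantumFieldTheory.Balaban1983to89.B12NodeKnitRecord8 (b12_main_of_leaf_of_thm3Member b12_main_iff_leaf_of_thm3Member)
open Literature.MathematicalPhysics.QuantumFieldTheory.Balaban1983to89.B12NodeKnitRecord11 (thm3Member_stage11_of_hRestrict)
open YMDAG.UVSplit (RecordPred Datum AtRecord S_N09)
open scoped Matrix.Norms.L2Operator

variable {N : ℕ} [NeZero N]

/-! ## §1. At the five-pin Stage-11 carrier record `IsRecordOfRecord₁₁CB10YZWB8` (S-bound world; the [B12] group of `X` still FREE) -/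

section FivePin

variable {F : T4Family} {D : Datum F N} {w : WorldP}

/-- **THE S-BINDING KEEPS THE [B12 §§2–5] GROUP** (generic Stage-5 parameters): the `b12` leaf of `upOfRecord₅CS θ₅ P` IS Lemma 4 (3.53) over the group of the run's
residual carrier `θ₅.res.X P` (`Iff.rfl`: the Stage-3 substitutions, the compact `b10` and the surviving `b8` re-bindings never touch `F12` ∕ `c12`).  Read below at
`θ₅ :=` g31's five-pin view `θ.view₁₁B8B10YZW λ M⋆ ops ζ λW`, whose `X` differs from `θ.res.X` in its [B8] ∕ [B10] groups only — the [B12] group there is the FREE one.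
[cite: Balaban1987RG1, Lemma 4 (3.53) p.280 (the leaf at the objects of record; bookkeeping)] -/
theorem upOfRecord₅CS_b12_iff (θ₅ : Stage5Params F N) (P : B12.RunParams) :
    (upOfRecord₅CS F N θ₅ P).b12 ↔ B12Sec2to5.Lemma4Printed (θ₅.res.X P).F12 (θ₅.res.X P).c12 :=
  Iff.rfl

/-- **At a five-pin Stage-11 record N09 IS «b8 → b9 → b10 → b11 → (b12 ∧ member)»**: the four in-edges `b4 b5 b6 b7` are THEOREMS there (g31's
`b4_b5_b6_b7_of_isRecordOfRecord₁₁CB10YZWB8`, via the same-datum companion), so they drop out of `Dag.B12_main`.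
[cite: Balaban1987RG1, Lemma 4 (3.53) p.280, Thm 1 p.259 and Thm 3 p.264 (the node's shape; bookkeeping)] -/
theorem b12_main_iff_of_isRecordOfRecord₁₁CB10YZWB8 (h : IsRecordOfRecord₁₁CB10YZWB8 F N D w) (P : B12.RunParams) :
    Dag.B12_main (leavesP w P) ↔
      ((leavesP w P).b8 → (leavesP w P).b9 → (leavesP w P).b10 → (leavesP w P).b11 →
        ((leavesP w P).b12 ∧ ((leavesP w P).b12 → (leavesP w P).b13 → ((leavesP w P).smallCouplings → (leavesP w P).smallFieldInductive)))) := by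
  obtain ⟨h4, h5, h6, h7⟩ := b4_b5_b6_b7_of_isRecordOfRecord₁₁CB10YZWB8 h P
  exact ⟨fun hN h8 h9 h10 h11 => hN h4 h5 h6 h7 h8 h9 h10 h11, fun hN _ _ _ _ h8 h9 h10 h11 => hN h8 h9 h10 h11⟩

/-- **THE OWN LEAF AT A FIVE-PIN RECORD, UNFOLDED** over the presenting package: `(leavesP w P).b12 ↔ B12Sec2to5.Lemma4Printed (X′ P).F12 (X′ P).c12` at the view's carrier
`X′ := (θ.view₁₁B8B10YZW λ M⋆ ops ζ λW).res.X` — Lemma 4 over the FREE [B12 §§2–5] group of the run's residual carrier (the view re-binds the [B8] ∕ [B10] groups of `θ.res.X`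
only; the form N24's module 21 `slots₁₀` reads). [cite: Balaban1987RG1, Lemma 4 (3.53) p.280 (the leaf at the objects of record; bookkeeping)] -/
theorem b12_leaf_iff_of_isRecordOfRecord₁₁CB10YZWB8 (h : IsRecordOfRecord₁₁CB10YZWB8 F N D w) :
    ∃ (θ : Stage11Params F N) (hP : θ.Provisos₁₁) (lam : ResidB8 θ.toStage3Params) (Mstar : ℕ) (ops : OpsY N θ.toStage3Params Mstar) (ζ : ResidZ F N)
      (lamW : ResidW F N), θ.Admissible ∧ D = datumOfRecord₁₁ F N θ hP ∧ (∀ P, w.up P = upOfRecord₅CS F N (θ.view₁₁B8B10YZW F N lam Mstar ops ζ lamW) P) ∧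
        ∀ P : B12.RunParams, (leavesP w P).b12 ↔
          B12Sec2to5.Lemma4Printed ((θ.view₁₁B8B10YZW F N lam Mstar ops ζ lamW).res.X P).F12 ((θ.view₁₁B8B10YZW F N lam Mstar ops ζ lamW).res.X P).c12 := by
  obtain ⟨θ, hP, lam, Mstar, ops, ζ, lamW, hθ, hD, -, -, -, hup⟩ := h
  refine ⟨θ, hP, lam, Mstar, ops, ζ, lamW, hθ, hD, hup, fun P => ?_⟩
  show (w.up P).b12 ↔ _
  rw [hup P]
  exact upOfRecord₅CS_b12_iff _ P

/-- **THE THEOREM-3 MEMBER OF N09 AT EVERY RUN OF A FIVE-PIN RECORD FROM [B11] THM 1 AT THE RECORD'S OBJECTS** — the ₁₁C binders VERBATIM ((1.1) on the level domains,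
`HRestrict`, uniqueness at the averaged minimisers, over the presenting Stage-11 parameters and their provisos): MODULE 3′'s θ-explicit `thm3Member_stage11_of_hRestrict`
(the record's world is bound to `(datumOfRecord₁₁ θ hP).C`; the composition ∕ invariance inputs are theorems fed by `hP.base.contT`).
[cite: Balaban1987RG1, Thm 3 p.264, (1.1)–(1.3) p.260 and (2.16) p.269; Balaban1985Variational, Thm 1 (8)–(10) p.279] -/
theorem thm3Member_of_isRecordOfRecord₁₁CB10YZWB8_of_hRestrict (h : IsRecordOfRecord₁₁CB10YZWB8 F N D w)
    (h11 : ∀ θ : Stage11Params F N, ∀ hP : θ.Provisos₁₁, θ.Admissible → D = datumOfRecord₁₁ F N θ hP → w.γ ≤ θ.γ →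
      ∀ (p : B12.RunParams) (k : ℕ), k ≤ p.K →
        ∀ V ∈ domAltOfRecord F N θ.ν p.K k, UkExists F N p.K k θ.εbg V ∧ UniqueUkOrbit F N p.K k θ.εbg V)
    (hres : ∀ θ : Stage11Params F N, ∀ hP : θ.Provisos₁₁, θ.Admissible → D = datumOfRecord₁₁ F N θ hP → w.γ ≤ θ.γ →
      ∀ (p : B12.RunParams) (k : ℕ), k ≤ p.K → HRestrict F N θ.εbg p.K k (domAltOfRecord F N θ.ν p.K k))
    (huniq : ∀ θ : Stage11Params F N, ∀ hP : θ.Provisos₁₁, θ.Admissible → D = datumOfRecord₁₁ F N θ hP → w.γ ≤ θ.γ →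
      ∀ (p : B12.RunParams) (k : ℕ), k ≤ p.K → ∀ V ∈ domAltOfRecord F N θ.ν p.K k, ∀ j < k,
        UniqueUkOrbit F N p.K (j + 1) θ.εbg (Averaging.iter (avOfRecord F N p.K) (j + 1) (Uk F N p.K k θ.εbg V)))
    (P : B12.RunParams) : (leavesP w P).smallCouplings → (leavesP w P).smallFieldInductive := by
  obtain ⟨θ, hP, -, -, -, -, -, hθ, hD, hC, hγ, -, -⟩ := h
  have hC' : w.C = (datumOfRecord₁₁ F N θ hP).C := by rw [hC, hD]
  exact thm3Member_stage11_of_hRestrict θ hP hC' P (fun k hk => h11 θ hP hθ hD hγ.2 P k hk) (fun k hk => hres θ hP hθ hD hγ.2 P k hk)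
    (fun k hk => huniq θ hP hθ hD hγ.2 P k hk)

/-- **N09 AT EVERY RUN OF A FIVE-PIN RECORD** — the world-level binder `h09 : ∀ P, Dag.B12_main (leavesP w P)` of N24's engine `Node00.N24_at_record₁₁CB10YZWB8` PRODUCED from
the pin slot (Lemma 4 over the free [B12] group at every presenting five-pin package, keyed like g31's `b8_main_of_…_of_slots`) and the [B11] binders.
[cite: Balaban1987RG1, Lemma 4 (3.53) p.280, Thm 1 p.259 and Thm 3 p.264; Balaban1985Variational, Thm 1 p.279] -/
theorem b12_main_of_isRecordOfRecord₁₁CB10YZWB8_of_slot (h : IsRecordOfRecord₁₁CB10YZWB8 F N D w)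
    (slot12 : ∀ (θ : Stage11Params F N) (hP : θ.Provisos₁₁) (lam : ResidB8 θ.toStage3Params) (Mstar : ℕ) (ops : OpsY N θ.toStage3Params Mstar) (ζ : ResidZ F N)
      (lamW : ResidW F N), θ.Admissible → D = datumOfRecord₁₁ F N θ hP →
        (∀ P, w.up P = upOfRecord₅CS F N (θ.view₁₁B8B10YZW F N lam Mstar ops ζ lamW) P) → ∀ P : B12.RunParams,
          B12Sec2to5.Lemma4Printed ((θ.view₁₁B8B10YZW F N lam Mstar ops ζ lamW).res.X P).F12 ((θ.view₁₁B8B10YZW F N lam Mstar ops ζ lamW).res.X P).c12)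
    (h11 : ∀ θ : Stage11Params F N, ∀ hP : θ.Provisos₁₁, θ.Admissible → D = datumOfRecord₁₁ F N θ hP → w.γ ≤ θ.γ →
      ∀ (p : B12.RunParams) (k : ℕ), k ≤ p.K →
        ∀ V ∈ domAltOfRecord F N θ.ν p.K k, UkExists F N p.K k θ.εbg V ∧ UniqueUkOrbit F N p.K k θ.εbg V)
    (hres : ∀ θ : Stage11Params F N, ∀ hP : θ.Provisos₁₁, θ.Admissible → D = datumOfRecord₁₁ F N θ hP → w.γ ≤ θ.γ →
      ∀ (p : B12.RunParams) (k : ℕ), k ≤ p.K → HRestrict F N θ.εbg p.K k (domAltOfRecord F N θ.ν p.K k))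
    (huniq : ∀ θ : Stage11Params F N, ∀ hP : θ.Provisos₁₁, θ.Admissible → D = datumOfRecord₁₁ F N θ hP → w.γ ≤ θ.γ →
      ∀ (p : B12.RunParams) (k : ℕ), k ≤ p.K → ∀ V ∈ domAltOfRecord F N θ.ν p.K k, ∀ j < k,
        UniqueUkOrbit F N p.K (j + 1) θ.εbg (Averaging.iter (avOfRecord F N p.K) (j + 1) (Uk F N p.K k θ.εbg V))) :
    ∀ P : B12.RunParams, Dag.B12_main (leavesP w P) := by
  intro P
  have hT := thm3Member_of_isRecordOfRecord₁₁CB10YZWB8_of_hRestrict h h11 hres huniq P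
  obtain ⟨θ, hP, lam, Mstar, ops, ζ, lamW, hθ, hD, -, -, -, hup⟩ := h
  have h12 : (leavesP w P).b12 := by
    show (w.up P).b12
    rw [hup P]
    exact (upOfRecord₅CS_b12_iff _ P).2 (slot12 θ hP lam Mstar ops ζ lamW hθ hD hup P)
  exact b12_main_of_leaf_of_thm3Member h12 hT

end FivePin

/-! ## §2. At the six-pin Stage-11 carrier record `IsRecordOfRecord₁₁CB10YZWB8B12` — THE STAGE NAMING THE [B12 §§2–5] GROUP -/

section SixPin

variable {F : T4Family} {D : Datum F N} {w : WorldP}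

/-- **At a six-pin Stage-11 record N09 IS «b8 → b9 → b10 → b11 → (b12 ∧ member)»** (SAME `(D, w)` as a five-pin record: g32's
`isRecordOfRecord₁₁CB10YZWB8_of_isRecordOfRecord₁₁CB10YZWB8B12`). [cite: Balaban1987RG1, Lemma 4 (3.53) p.280 and Thm 3 p.264 (bookkeeping)] -/
theorem b12_main_iff_of_isRecordOfRecord₁₁CB10YZWB8B12 (h : IsRecordOfRecord₁₁CB10YZWB8B12 F N D w) (P : B12.RunParams) :
    Dag.B12_main (leavesP w P) ↔
      ((leavesP w P).b8 → (leavesP w P).b9 → (leavesP w P).b10 → (leavesP w P).b11 →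
        ((leavesP w P).b12 ∧ ((leavesP w P).b12 → (leavesP w P).b13 → ((leavesP w P).smallCouplings → (leavesP w P).smallFieldInductive)))) :=
  b12_main_iff_of_isRecordOfRecord₁₁CB10YZWB8 (isRecordOfRecord₁₁CB10YZWB8_of_isRecordOfRecord₁₁CB10YZWB8B12 h) P

/-- **THE THEOREM-3 MEMBER AT EVERY RUN OF A SIX-PIN RECORD FROM [B11] THM 1 AT THE RECORD'S OBJECTS** (the ₁₁C binders VERBATIM; same `(D, w)` as the five-pin record).
[cite: Balaban1987RG1, Thm 3 p.264, (1.1)–(1.3) p.260 and (2.16) p.269; Balaban1985Variational, Thm 1 (8)–(10) p.279] -/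
theorem thm3Member_of_isRecordOfRecord₁₁CB10YZWB8B12_of_hRestrict (h : IsRecordOfRecord₁₁CB10YZWB8B12 F N D w)
    (h11 : ∀ θ : Stage11Params F N, ∀ hP : θ.Provisos₁₁, θ.Admissible → D = datumOfRecord₁₁ F N θ hP → w.γ ≤ θ.γ →
      ∀ (p : B12.RunParams) (k : ℕ), k ≤ p.K →
        ∀ V ∈ domAltOfRecord F N θ.ν p.K k, UkExists F N p.K k θ.εbg V ∧ UniqueUkOrbit F N p.K k θ.εbg V)
    (hres : ∀ θ : Stage11Params F N, ∀ hP : θ.Provisos₁₁, θ.Admissible → D = datumOfRecord₁₁ F N θ hP → w.γ ≤ θ.γ →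
      ∀ (p : B12.RunParams) (k : ℕ), k ≤ p.K → HRestrict F N θ.εbg p.K k (domAltOfRecord F N θ.ν p.K k))
    (huniq : ∀ θ : Stage11Params F N, ∀ hP : θ.Provisos₁₁, θ.Admissible → D = datumOfRecord₁₁ F N θ hP → w.γ ≤ θ.γ →
      ∀ (p : B12.RunParams) (k : ℕ), k ≤ p.K → ∀ V ∈ domAltOfRecord F N θ.ν p.K k, ∀ j < k,
        UniqueUkOrbit F N p.K (j + 1) θ.εbg (Averaging.iter (avOfRecord F N p.K) (j + 1) (Uk F N p.K k θ.εbg V)))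
    (P : B12.RunParams) : (leavesP w P).smallCouplings → (leavesP w P).smallFieldInductive := by
  obtain ⟨θ, hP, -, -, -, -, -, -, hθ, hD, hC, hγ, -, -⟩ := h
  have hC' : w.C = (datumOfRecord₁₁ F N θ hP).C := by rw [hC, hD]
  exact thm3Member_stage11_of_hRestrict θ hP hC' P (fun k hk => h11 θ hP hθ hD hγ.2 P k hk) (fun k hk => hres θ hP hθ hD hγ.2 P k hk)
    (fun k hk => huniq θ hP hθ hD hγ.2 P k hk)

/-- **N09 READ AT THE SIX PINNED BUNDLES OF RECORD, for ONE parameter package** (given its member): «`B8LeafOfRecord θ₃ λ` → `B9LeafX (Y9OfRecord N θ₃ M⋆ ops)` →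
`PrintedUV3V N θ.L` → `B11Leaf (Z11OfRecord F N ζ)` → `B12LeafOfRecord₁₁ F N θ λ₁₂ P`» — the in-edges at their groups of record (g32's `leaves_iff_of_…`), the
conclusion Lemma 4 (3.53) at the frame of record. [cite: Balaban1987RG1, Lemma 4 (3.53) p.280; Balaban1985RegularSpaces, Thm 8 p.101; Balaban1985BackgroundPropagators, Thm 3.1 p.397; Balaban1985UV3, Thm 1 p.257; Balaban1985Variational, Thm 1 p.279 (the node at the pinned objects; bookkeeping)] -/
theorem b12_main_iff_bundles_of_isRecordOfRecord₁₁CB10YZWB8B12 (h : IsRecordOfRecord₁₁CB10YZWB8B12 F N D w)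
    (h11 : ∀ θ : Stage11Params F N, ∀ hP : θ.Provisos₁₁, θ.Admissible → D = datumOfRecord₁₁ F N θ hP → w.γ ≤ θ.γ →
      ∀ (p : B12.RunParams) (k : ℕ), k ≤ p.K →
        ∀ V ∈ domAltOfRecord F N θ.ν p.K k, UkExists F N p.K k θ.εbg V ∧ UniqueUkOrbit F N p.K k θ.εbg V)
    (hres : ∀ θ : Stage11Params F N, ∀ hP : θ.Provisos₁₁, θ.Admissible → D = datumOfRecord₁₁ F N θ hP → w.γ ≤ θ.γ →
      ∀ (p : B12.RunParams) (k : ℕ), k ≤ p.K → HRestrict F N θ.εbg p.K k (domAltOfRecord F N θ.ν p.K k))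
    (huniq : ∀ θ : Stage11Params F N, ∀ hP : θ.Provisos₁₁, θ.Admissible → D = datumOfRecord₁₁ F N θ hP → w.γ ≤ θ.γ →
      ∀ (p : B12.RunParams) (k : ℕ), k ≤ p.K → ∀ V ∈ domAltOfRecord F N θ.ν p.K k, ∀ j < k,
        UniqueUkOrbit F N p.K (j + 1) θ.εbg (Averaging.iter (avOfRecord F N p.K) (j + 1) (Uk F N p.K k θ.εbg V))) :
    ∃ (θ : Stage11Params F N) (lam12 : ResidB12 F N θ.τ9.M) (lam : ResidB8 θ.toStage3Params) (Mstar : ℕ) (ops : OpsY N θ.toStage3Params Mstar) (ζ : ResidZ F N),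
      θ.Admissible ∧ w.L = (θ.L : ℝ) ∧ ∀ P : B12.RunParams,
        Dag.B12_main (leavesP w P) ↔
          (B8LeafOfRecord θ.toStage3Params lam → B9LeafX (Y9OfRecord N θ.toStage3Params Mstar ops) → PrintedUV3V N θ.L →
            B11Leaf (Z11OfRecord F N ζ) → B12LeafOfRecord₁₁ F N θ lam12 P) := by
  have hT := thm3Member_of_isRecordOfRecord₁₁CB10YZWB8B12_of_hRestrict h h11 hres huniq
  have h4 := b4_b5_b6_b7_of_isRecordOfRecord₁₁CB10YZWB8 (isRecordOfRecord₁₁CB10YZWB8_of_isRecordOfRecord₁₁CB10YZWB8B12 h)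
  obtain ⟨θ, lam12, lam, Mstar, ops, ζ, lamW, hθ, hL, hl⟩ := leaves_iff_of_isRecordOfRecord₁₁CB10YZWB8B12 h
  refine ⟨θ, lam12, lam, Mstar, ops, ζ, hθ, hL, fun P => ?_⟩
  obtain ⟨h12, h8, -, h9, h10, h11'⟩ := hl P
  rw [b12_main_iff_leaf_of_thm3Member (hT P), ← h12, ← h8, ← h9, ← h10, ← h11']
  obtain ⟨h4', h5, h6, h7⟩ := h4 P
  exact ⟨fun hN hb8 hb9 hb10 hb11 => hN h4' h5 h6 h7 hb8 hb9 hb10 hb11, fun hN _ _ _ _ hb8 hb9 hb10 hb11 => hN hb8 hb9 hb10 hb11⟩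

/-- **N09 AT EVERY RUN OF A SIX-PIN RECORD FROM g32's SLOTS** («for every presenting six-pin package, Lemma 4 at the frame of record at every run»:
`Node00.b12_leaf_of_isRecordOfRecord₁₁CB10YZWB8B12_of_slots` BY NAME) **and the [B11] binders** — conjunct 1 AT THE STAGE NAMING THE GROUP, the member from [B11] Thm 1
at the record's objects. [cite: Balaban1987RG1, Lemma 4 (3.53) p.280, Thm 1 p.259 and Thm 3 p.264; Balaban1985Variational, Thm 1 p.279] -/
theorem b12_main_of_isRecordOfRecord₁₁CB10YZWB8B12_of_slots (h : IsRecordOfRecord₁₁CB10YZWB8B12 F N D w)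
    (hB12 : ∀ (θ : Stage11Params F N) (hP : θ.Provisos₁₁) (lam12 : ResidB12 F N θ.τ9.M) (lam : ResidB8 θ.toStage3Params) (Mstar : ℕ)
      (ops : OpsY N θ.toStage3Params Mstar) (ζ : ResidZ F N) (lamW : ResidW F N), θ.Admissible → D = datumOfRecord₁₁ F N θ hP →
        (∀ P, w.up P = upOfRecord₅CS F N (θ.view₁₁B12B8B10YZW F N lam12 lam Mstar ops ζ lamW) P) → ∀ P, B12LeafOfRecord₁₁ F N θ lam12 P)
    (h11 : ∀ θ : Stage11Params F N, ∀ hP : θ.Provisos₁₁, θ.Admissible → D = datumOfRecord₁₁ F N θ hP → w.γ ≤ θ.γ →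
      ∀ (p : B12.RunParams) (k : ℕ), k ≤ p.K →
        ∀ V ∈ domAltOfRecord F N θ.ν p.K k, UkExists F N p.K k θ.εbg V ∧ UniqueUkOrbit F N p.K k θ.εbg V)
    (hres : ∀ θ : Stage11Params F N, ∀ hP : θ.Provisos₁₁, θ.Admissible → D = datumOfRecord₁₁ F N θ hP → w.γ ≤ θ.γ →
      ∀ (p : B12.RunParams) (k : ℕ), k ≤ p.K → HRestrict F N θ.εbg p.K k (domAltOfRecord F N θ.ν p.K k))
    (huniq : ∀ θ : Stage11Params F N, ∀ hP : θ.Provisos₁₁, θ.Admissible → D = datumOfRecord₁₁ F N θ hP → w.γ ≤ θ.γ →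
      ∀ (p : B12.RunParams) (k : ℕ), k ≤ p.K → ∀ V ∈ domAltOfRecord F N θ.ν p.K k, ∀ j < k,
        UniqueUkOrbit F N p.K (j + 1) θ.εbg (Averaging.iter (avOfRecord F N p.K) (j + 1) (Uk F N p.K k θ.εbg V))) :
    ∀ P : B12.RunParams, Dag.B12_main (leavesP w P) :=
  fun P => b12_main_of_leaf_of_thm3Member (b12_leaf_of_isRecordOfRecord₁₁CB10YZWB8B12_of_slots h hB12 P)
    (thm3Member_of_isRecordOfRecord₁₁CB10YZWB8B12_of_hRestrict h h11 hres huniq P)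

/-- **N09 AT EVERY RUN OF A SIX-PIN RECORD FROM THE LEAF SLOT KEYED ON `(θ, hP, λ₁₂)` ALONE** («for every presenting Stage-11 parameter with provisos and every residual [B12]
layer presenting the record: Lemma 4 at the frame of record at every run») **and the [B11] binders** — the slot is EXACTLY what the companion's package face
(«admissible `θ` + the displayed `Lemma4Data` law-fields at `(θ.Rz P.K, θ.s2.cB, λ₁₂ P)` ⇒ `B12LeafOfRecord₁₁ F N θ λ₁₂ P», p07's `lemma4Printed_frameOf` BY NAME) fills.
[cite: Balaban1987RG1, Lemma 4 (3.53) p.280, Thm 1 p.259 and Thm 3 p.264; Balaban1985Variational, Thm 1 p.279] -/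
theorem b12_main_of_isRecordOfRecord₁₁CB10YZWB8B12_of_leafSlot (h : IsRecordOfRecord₁₁CB10YZWB8B12 F N D w)
    (hleaf : ∀ (θ : Stage11Params F N) (hP : θ.Provisos₁₁) (lam12 : ResidB12 F N θ.τ9.M), θ.Admissible → D = datumOfRecord₁₁ F N θ hP →
      ∀ P, B12LeafOfRecord₁₁ F N θ lam12 P)
    (h11 : ∀ θ : Stage11Params F N, ∀ hP : θ.Provisos₁₁, θ.Admissible → D = datumOfRecord₁₁ F N θ hP → w.γ ≤ θ.γ →
      ∀ (p : B12.RunParams) (k : ℕ), k ≤ p.K →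
        ∀ V ∈ domAltOfRecord F N θ.ν p.K k, UkExists F N p.K k θ.εbg V ∧ UniqueUkOrbit F N p.K k θ.εbg V)
    (hres : ∀ θ : Stage11Params F N, ∀ hP : θ.Provisos₁₁, θ.Admissible → D = datumOfRecord₁₁ F N θ hP → w.γ ≤ θ.γ →
      ∀ (p : B12.RunParams) (k : ℕ), k ≤ p.K → HRestrict F N θ.εbg p.K k (domAltOfRecord F N θ.ν p.K k))
    (huniq : ∀ θ : Stage11Params F N, ∀ hP : θ.Provisos₁₁, θ.Admissible → D = datumOfRecord₁₁ F N θ hP → w.γ ≤ θ.γ →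
      ∀ (p : B12.RunParams) (k : ℕ), k ≤ p.K → ∀ V ∈ domAltOfRecord F N θ.ν p.K k, ∀ j < k,
        UniqueUkOrbit F N p.K (j + 1) θ.εbg (Averaging.iter (avOfRecord F N p.K) (j + 1) (Uk F N p.K k θ.εbg V))) :
    ∀ P : B12.RunParams, Dag.B12_main (leavesP w P) :=
  b12_main_of_isRecordOfRecord₁₁CB10YZWB8B12_of_slots h (fun θ hP lam12 _ _ _ _ _ hθ hD _ => hleaf θ hP lam12 hθ hD) h11 hres huniq

/-- **`S_N09 Rec` FOR EVERY RECORD PREDICATE REFINING THE SIX-PIN RECORD** (∀-currency), from the leaf slot and the [B11] binders stated uniformly.  NOT an N09 target by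
itself (`λ₁₂` is law-free data: wild letters falsify the leaf — `CarriersB12` header, junk analysis); the per-record ∕ ∃-currency forms are what consumers port.
[cite: Balaban1987RG1, Lemma 4 (3.53) p.280 and Thm 3 p.264; Balaban1985Variational, Thm 1 p.279 (bookkeeping)] -/
theorem s_N09_of_refines₁₁CB10YZWB8B12 (Rec : RecordPred N)
    (href : ∀ (F : T4Family) (D : Datum F N) (w : WorldP), Rec F D w → IsRecordOfRecord₁₁CB10YZWB8B12 F N D w)
    (hleaf : ∀ (F : T4Family) (D : Datum F N) (w : WorldP), Rec F D w →
      ∀ (θ : Stage11Params F N) (hP : θ.Provisos₁₁) (lam12 : ResidB12 F N θ.τ9.M), θ.Admissible → D = datumOfRecord₁₁ F N θ hP →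
        ∀ P, B12LeafOfRecord₁₁ F N θ lam12 P)
    (h11 : ∀ (F : T4Family) (D : Datum F N) (w : WorldP), Rec F D w →
      ∀ θ : Stage11Params F N, ∀ hP : θ.Provisos₁₁, θ.Admissible → D = datumOfRecord₁₁ F N θ hP → w.γ ≤ θ.γ →
        ∀ (p : B12.RunParams) (k : ℕ), k ≤ p.K →
          ∀ V ∈ domAltOfRecord F N θ.ν p.K k, UkExists F N p.K k θ.εbg V ∧ UniqueUkOrbit F N p.K k θ.εbg V)
    (hres : ∀ (F : T4Family) (D : Datum F N) (w : WorldP), Rec F D w →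
      ∀ θ : Stage11Params F N, ∀ hP : θ.Provisos₁₁, θ.Admissible → D = datumOfRecord₁₁ F N θ hP → w.γ ≤ θ.γ →
        ∀ (p : B12.RunParams) (k : ℕ), k ≤ p.K → HRestrict F N θ.εbg p.K k (domAltOfRecord F N θ.ν p.K k))
    (huniq : ∀ (F : T4Family) (D : Datum F N) (w : WorldP), Rec F D w →
      ∀ θ : Stage11Params F N, ∀ hP : θ.Provisos₁₁, θ.Admissible → D = datumOfRecord₁₁ F N θ hP → w.γ ≤ θ.γ →
        ∀ (p : B12.RunParams) (k : ℕ), k ≤ p.K → ∀ V ∈ domAltOfRecord F N θ.ν p.K k, ∀ j < k,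
          UniqueUkOrbit F N p.K (j + 1) θ.εbg (Averaging.iter (avOfRecord F N p.K) (j + 1) (Uk F N p.K k θ.εbg V))) :
    S_N09 Rec :=
  fun F D w hR P =>
    b12_main_of_isRecordOfRecord₁₁CB10YZWB8B12_of_leafSlot (href F D w hR) (hleaf F D w hR) (h11 F D w hR) (hres F D w hR) (huniq F D w hR) P

end SixPin

/-! ### §2b. ∃-currency ∕ θ-explicit: any world bound over the six-pin view of ONE package -/
section View

variable {F : T4Family}

/-- **N09 AT EVERY RUN OF A WORLD BOUND OVER THE SIX-PIN VIEW OF A PACKAGE** (`w.C = (datumOfRecord₁₁ θ hP).C`, `w.up P = upOfRecord₅CS (θ.view₁₁B12B8B10YZW λ₁₂ λ M⋆ ops ζ λW) P`)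
**FROM LEMMA 4 AT THE FRAME OF RECORD at every run and [B11] THM 1 AT `θ`** — what N09 costs in K1's ∃-form («the prover CHOOSES the record», in particular `λ₁₂`): the
companion's package at the NAMED `λ₁₂` + N07's content at `θ`; no record predicate, no transfer. [cite: Balaban1987RG1, Lemma 4 (3.53) p.280, Thm 3 p.264 and (1.1)–(1.3) p.260; Balaban1985Variational, Thm 1 (8)–(10) p.279] -/
theorem b12_main_of_up_view₁₁B12B8B10YZW_of_leaf (θ : Stage11Params F N) (hP : θ.Provisos₁₁) (lam12 : ResidB12 F N θ.τ9.M) (lam : ResidB8 θ.toStage3Params)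
    (Mstar : ℕ) (ops : OpsY N θ.toStage3Params Mstar) (ζ : ResidZ F N) (lamW : ResidW F N) {w : WorldP} (hC : w.C = (datumOfRecord₁₁ F N θ hP).C)
    (hup : ∀ P, w.up P = upOfRecord₅CS F N (θ.view₁₁B12B8B10YZW F N lam12 lam Mstar ops ζ lamW) P)
    (hleaf : ∀ P : B12.RunParams, B12LeafOfRecord₁₁ F N θ lam12 P)
    (h11 : ∀ (P : B12.RunParams) (k : ℕ), k ≤ P.K → ∀ V ∈ domAltOfRecord F N θ.ν P.K k, UkExists F N P.K k θ.εbg V ∧ UniqueUkOrbit F N P.K k θ.εbg V)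
    (hres : ∀ (P : B12.RunParams) (k : ℕ), k ≤ P.K → HRestrict F N θ.εbg P.K k (domAltOfRecord F N θ.ν P.K k))
    (huniq : ∀ (P : B12.RunParams) (k : ℕ), k ≤ P.K → ∀ V ∈ domAltOfRecord F N θ.ν P.K k, ∀ j < k,
      UniqueUkOrbit F N P.K (j + 1) θ.εbg (Averaging.iter (avOfRecord F N P.K) (j + 1) (Uk F N P.K k θ.εbg V))) :
    ∀ P : B12.RunParams, Dag.B12_main (leavesP w P) := by
  intro P
  have h12 : (leavesP w P).b12 := by
    show (w.up P).b12
    rw [hup P]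
    exact (upOfRecord₅CS_view₁₁B12B8B10YZW_b12_iff F N θ lam12 lam Mstar ops ζ lamW P).2 (hleaf P)
  exact b12_main_of_leaf_of_thm3Member h12 (thm3Member_stage11_of_hRestrict θ hP hC P (h11 P) (hres P) (huniq P))

end View

/-! ## §4. Conjunct 1 BY THE COMPANION's PACKAGE FACE (`Node00.b12LeafOfRecord₁₁_of_package` = p07's `lemma4Printed_frameOf` BY NAME) -/

section Package

variable {F : T4Family} {D : Datum F N} {w : WorldP}

/-- **N09 AT EVERY RUN OF A SIX-PIN RECORD FROM THE DISPLAYED PACKAGE OF LEMMA 4 AT THE DATA OF RECORD** — «for every presenting Stage-11 parameter with provisos and every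
residual [B12] layer presenting the record: the companion's by-reference package `B12Package (θ.Rz P.K) θ.s2.cB (λ₁₂ P)` at every run» (p07's `Lemma4Data` law-fields that are
not theorems for the objects of record: 7 further restrictions, 7 region inclusions of the fundamental case, the `JInputs` package on the printed domain, `hKan` ∕ `hA2an`) —
**and the [B11] binders**: conjunct 1 AT THE STAGE NAMING THE PACKAGE through `Node00.b12LeafOfRecord₁₁_of_package`, member from [B11] Thm 1 at the record's objects.
GAP-STATED(package) by construction (ref-C READ #115 (B4)); NOT a discharge. [cite: Balaban1987RG1, Lemma 4 (3.53) p.280, Thm 1 p.259 and Thm 3 p.264; Balaban1985Variational, Thm 1 p.279] -/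
theorem b12_main_of_isRecordOfRecord₁₁CB10YZWB8B12_of_package (h : IsRecordOfRecord₁₁CB10YZWB8B12 F N D w)
    (hL : ∀ (θ : Stage11Params F N) (hP : θ.Provisos₁₁) (lam12 : ResidB12 F N θ.τ9.M), θ.Admissible → D = datumOfRecord₁₁ F N θ hP →
      ∀ P, B12Package (θ.Rz P.K) θ.s2.cB (lam12 P))
    (h11 : ∀ θ : Stage11Params F N, ∀ hP : θ.Provisos₁₁, θ.Admissible → D = datumOfRecord₁₁ F N θ hP → w.γ ≤ θ.γ →
      ∀ (p : B12.RunParams) (k : ℕ), k ≤ p.K →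
        ∀ V ∈ domAltOfRecord F N θ.ν p.K k, UkExists F N p.K k θ.εbg V ∧ UniqueUkOrbit F N p.K k θ.εbg V)
    (hres : ∀ θ : Stage11Params F N, ∀ hP : θ.Provisos₁₁, θ.Admissible → D = datumOfRecord₁₁ F N θ hP → w.γ ≤ θ.γ →
      ∀ (p : B12.RunParams) (k : ℕ), k ≤ p.K → HRestrict F N θ.εbg p.K k (domAltOfRecord F N θ.ν p.K k))
    (huniq : ∀ θ : Stage11Params F N, ∀ hP : θ.Provisos₁₁, θ.Admissible → D = datumOfRecord₁₁ F N θ hP → w.γ ≤ θ.γ →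
      ∀ (p : B12.RunParams) (k : ℕ), k ≤ p.K → ∀ V ∈ domAltOfRecord F N θ.ν p.K k, ∀ j < k,
        UniqueUkOrbit F N p.K (j + 1) θ.εbg (Averaging.iter (avOfRecord F N p.K) (j + 1) (Uk F N p.K k θ.εbg V))) :
    ∀ P : B12.RunParams, Dag.B12_main (leavesP w P) :=
  b12_main_of_isRecordOfRecord₁₁CB10YZWB8B12_of_leafSlot h
    (fun θ hP lam12 hθ hD P => b12LeafOfRecord₁₁_of_package F N θ hθ lam12 P (hL θ hP lam12 hθ hD P)) h11 hres huniq

/-- **∃-currency ∕ θ-explicit: N09 AT EVERY RUN OF A WORLD BOUND OVER THE SIX-PIN VIEW OF A PACKAGE FROM THE DISPLAYED PACKAGE AT THE NAMED `λ₁₂` and [B11] THM 1 AT `θ`**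
(the prover CHOOSES the record, in particular the residual [B12] layer; conjunct 1 = `b12LeafOfRecord₁₁_of_package` at every run). GAP-STATED(package); NOT a discharge.
[cite: Balaban1987RG1, Lemma 4 (3.53) p.280, Thm 3 p.264 and (1.1)–(1.3) p.260; Balaban1985Variational, Thm 1 (8)–(10) p.279] -/
theorem b12_main_of_up_view₁₁B12B8B10YZW_of_package (θ : Stage11Params F N) (hP : θ.Provisos₁₁) (hθ : θ.Admissible) (lam12 : ResidB12 F N θ.τ9.M)
    (lam : ResidB8 θ.toStage3Params) (Mstar : ℕ) (ops : OpsY N θ.toStage3Params Mstar) (ζ : ResidZ F N) (lamW : ResidW F N) {w : WorldP}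
    (hC : w.C = (datumOfRecord₁₁ F N θ hP).C) (hup : ∀ P, w.up P = upOfRecord₅CS F N (θ.view₁₁B12B8B10YZW F N lam12 lam Mstar ops ζ lamW) P)
    (L : ∀ P : B12.RunParams, B12Package (θ.Rz P.K) θ.s2.cB (lam12 P))
    (h11 : ∀ (P : B12.RunParams) (k : ℕ), k ≤ P.K → ∀ V ∈ domAltOfRecord F N θ.ν P.K k, UkExists F N P.K k θ.εbg V ∧ UniqueUkOrbit F N P.K k θ.εbg V)
    (hres : ∀ (P : B12.RunParams) (k : ℕ), k ≤ P.K → HRestrict F N θ.εbg P.K k (domAltOfRecord F N θ.ν P.K k))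
    (huniq : ∀ (P : B12.RunParams) (k : ℕ), k ≤ P.K → ∀ V ∈ domAltOfRecord F N θ.ν P.K k, ∀ j < k,
      UniqueUkOrbit F N P.K (j + 1) θ.εbg (Averaging.iter (avOfRecord F N P.K) (j + 1) (Uk F N P.K k θ.εbg V))) :
    ∀ P : B12.RunParams, Dag.B12_main (leavesP w P) :=
  b12_main_of_up_view₁₁B12B8B10YZW_of_leaf θ hP lam12 lam Mstar ops ζ lamW hC hup (fun P => b12LeafOfRecord₁₁_of_package F N θ hθ lam12 P (L P))
    h11 hres huniq

end Package

/-! ## §3. Guards — inhabitation, the member under re-binding, and what conjunct 1 costs in K1's ∃-currency (LOCATED) -/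

section Guards

variable {F : T4Family}

/-- **INHABITED-AT-₁₁CB10YZWB8B12 ⟺ INHABITED-AT-₁₁CB10YZWB8, family by family** — the sixth pin adds no proviso and no admissibility clause: one way g32's same-world
refinement; the other way a five-pin record's world RE-BOUND at the six-pin view of its own presenting package and ANY residual [B12] layer (`Node00.nonempty_residB12`).
(With n05-d ∕ n08-c's `inhabited₁₁CB10YZWB8_iff_inhabited₁₁C` the right-hand side is ₁₁C's inhabitation = K0 `Record11Inhabited`'s body at `N = 2` — neither proved nor
assumed here.) [cite: Balaban1989LargeFieldII, Thm 1 + (0.1) pp.355–356; Balaban1987RG1, Lemma 4 p.280 (objects of record; bookkeeping)] -/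
theorem inhabited₁₁CB10YZWB8B12_iff_inhabited₁₁CB10YZWB8 :
    (∃ (D : Datum F N) (w : WorldP), IsRecordOfRecord₁₁CB10YZWB8B12 F N D w) ↔
      ∃ (D : Datum F N) (w : WorldP), IsRecordOfRecord₁₁CB10YZWB8 F N D w := by
  refine ⟨fun ⟨D, w, h⟩ => ⟨D, w, isRecordOfRecord₁₁CB10YZWB8_of_isRecordOfRecord₁₁CB10YZWB8B12 h⟩, fun ⟨D, w, h⟩ => ?_⟩
  obtain ⟨θ, hP, lam, Mstar, ops, ζ, lamW, hθ, hD, hC, hγ, hL, -⟩ := h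
  obtain ⟨lam12⟩ := nonempty_residB12 F N θ.τ9.M
  exact ⟨D, { w with up := fun P => upOfRecord₅CS F N (θ.view₁₁B12B8B10YZW F N lam12 lam Mstar ops ζ lamW) P },
    ⟨θ, hP, lam12, lam, Mstar, ops, ζ, lamW, hθ, hD, hC, hγ, hL, fun _ => rfl⟩⟩

omit [NeZero N] in
/-- `smallCouplings` reads the world's construction and window only: unchanged under an `up`-re-binding (`Iff.rfl`). [cite: Balaban1987RG1, (0.17) p.255 (bookkeeping)] -/
theorem smallCouplings_rebind (w : WorldP) (up' : B12.RunParams → DagBinding.Upstream) (P : B12.RunParams) :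
    (leavesP { w with up := up' } P).smallCouplings ↔ (leavesP w P).smallCouplings := Iff.rfl

omit [NeZero N] in
/-- `smallFieldInductive` reads the world's construction only: unchanged under an `up`-re-binding (`Iff.rfl`). [cite: Balaban1987RG1, (1.1)–(1.6) pp.260–261 (bookkeeping)] -/
theorem smallFieldInductive_rebind (w : WorldP) (up' : B12.RunParams → DagBinding.Upstream) (P : B12.RunParams) :
    (leavesP { w with up := up' } P).smallFieldInductive ↔ (leavesP w P).smallFieldInductive := Iff.rfl

/-- **WHAT N09's CONJUNCT 1 COSTS IN K1's ∃-CURRENCY (LOCATED)**: every Stage-11 record `(D, w)` of `IsRecordOfRecord₁₁C` is RE-PRESENTED — SAME datum `D`, same construction,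
window, block size, hence THE SAME Theorem-3 member at every run — for EVERY residual [B12] layer `λ₁₂` (and every [B8] layer, floor, operator layer, [B11] ∕ [IV] layer) OF THE
PROVER'S CHOICE by a six-pin world `w′` at which the own leaf IS Lemma 4 at the frame of record `B12LeafOfRecord₁₁ F N θ λ₁₂ P` at EVERY run (g32's
`isRecordOfRecord₁₁CB10YZWB8B12_rebind_of_isRecordOfRecord₁₁C` + the `b12` face of the six-pin view).  So in the V1 ∃-form of K1 `StabilityBAtRecordR11e` the N09 conjunct of
`DagBinding.Nodes` at the chosen record costs EXACTLY the companion's displayed package at a NAMED `λ₁₂` (conjunct 1) + [B11] Thm 1 at the record's domains (member) — never less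
(wild letters `𝐊`, `𝐀₂` falsify the leaf; `CarriersB12` header).  NOT-A-DISCHARGE. [cite: Balaban1987RG1, Lemma 4 (3.53) p.280 and Thm 3 p.264 (bookkeeping: the node at the re-presented Stage-11 record)] -/
theorem exists_rebind₁₁CB10YZWB8B12_of_isRecordOfRecord₁₁C {D : Datum F N} {w : WorldP} (h : IsRecordOfRecord₁₁C F N D w) :
    ∃ (θ : Stage11Params F N) (hP : θ.Provisos₁₁), θ.Admissible ∧ D = datumOfRecord₁₁ F N θ hP ∧ w.L = (θ.L : ℝ) ∧
      ∀ (lam12 : ResidB12 F N θ.τ9.M) (lam : ResidB8 θ.toStage3Params) (Mstar : ℕ) (ops : OpsY N θ.toStage3Params Mstar) (ζ : ResidZ F N) (lamW : ResidW F N),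
        ∃ w' : WorldP, IsRecordOfRecord₁₁CB10YZWB8B12 F N D w' ∧ w'.C = w.C ∧ w'.γ = w.γ ∧ w'.L = w.L ∧
          ∀ P : B12.RunParams, ((leavesP w' P).b12 ↔ B12LeafOfRecord₁₁ F N θ lam12 P) ∧
            ((leavesP w' P).smallCouplings ↔ (leavesP w P).smallCouplings) ∧ ((leavesP w' P).smallFieldInductive ↔ (leavesP w P).smallFieldInductive) := by
  obtain ⟨θ, hP, hθ, hD, hC, hγ, hL, -⟩ := h
  refine ⟨θ, hP, hθ, hD, hL, fun lam12 lam Mstar ops ζ lamW => ?_⟩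
  exact ⟨{ w with up := fun P => upOfRecord₅CS F N (θ.view₁₁B12B8B10YZW F N lam12 lam Mstar ops ζ lamW) P },
    ⟨θ, hP, lam12, lam, Mstar, ops, ζ, lamW, hθ, hD, hC, hγ, hL, fun _ => rfl⟩, rfl, rfl, rfl,
    fun P => ⟨upOfRecord₅CS_view₁₁B12B8B10YZW_b12_iff F N θ lam12 lam Mstar ops ζ lamW P, Iff.rfl, Iff.rfl⟩⟩

end Guards

end Summit.QuantumFields.YangMills.BalabanUVNodes.N09AtRecord11CB10YZWB8B12

end
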